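import Summits.BirchSwinnertonDyer.Rank1Residual.Additive.PadicClosureCyclotomicRoots
import Mathlib.FieldTheory.Minpoly.IsConjRoot
import Mathlib.FieldTheory.Galois.Infinite
import HarnessLib

/-!
# The local cyclotomic tower INSIDE `ℚ̄_p = PadicAlgCl p`, II: orthogonality of the `π`-power basis,
# `minpoly_{ℚ_p} ζ_{p^m} = Φ_{p^m}` (`[ℚ_p(ζ_{p^m}) : ℚ_p] = φ(p^m)`), the layers `ℚ_p(ζ_{p^m})` and
# the Galois supply — cell `b2b-bsdres`, CLASS-CLOSURE lane, class O10 — x1b GEN 33, class lead;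
# file 19 of the local series (port of the second half of `PAdicHodge/CyclotomicTower.lean`)

HONEST FRAMING (cell `b2b-bsdres`, run/shared/lean/b2b/bsd-rank1-residual/, verbatim in every
file): the goal of the cell is to DELETE the COMBINATION-SHAPED residual classes of the
Birch–Swinnerton-Dyer formula for ALL analytic-rank `≤ 1` elliptic curves over `ℚ` — "full BSD
formula for every rank `≤ 1` curve in class `C`" assembled STRICTLY from published theorems — so
that the rank-`≤ 1` remainder becomes exactly the CONSTRUCTION-SHAPED classes, which are TYPED
(missing-input `Prop`s), NOT attempted. This is not "finishing BSD". CLASS-CLOSURE lane: prove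
what is provable now; shrink each hard class to its core with data; no claim beyond stated classes;
research routes on CONSTRUCTION-SHAPED X12 / O10; census / instrument output = EVIDENCE / conjecture
items, NEVER a Literature fact; `RESIDUAL-MAP.md` marks change only by signed lines. THIS FILE:
TOOL DEFINITION + THEOREMS (one definition with body: `layer p m = ℚ_p⟮ζ m⟯`; every statement
proved) — no named Literature fact, no Summits-side fact `def … : Prop`, no `sorry`, axioms
standard; nothing is booked; no label / mark / count / sub-cell moves; O10 stays OPEN /
CONSTRUCTION-SHAPED; nothing about `BSD(W, p)` of any pair is claimed.

## What is here (`Ω = PadicAlgCl p`, `ζ m = zeta p m`, `π = ζ m − 1`)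

* §3 `eq_of_norm_mul_norm_pow_eq`, **`norm_coeff_mul_le_norm_aeval`** (orthogonality of the
  `π`-power basis over `ℚ_p`: `‖r_j‖ ‖π‖^j ≤ ‖r(π)‖` for `deg r < φ(p^m)` — the non-zero terms have
  pairwise distinct absolute values, value group `p^ℤ` of `ℚ_p` versus `‖π‖^{φ(p^m)} = ‖p‖`), hence
  **`minpoly_zeta : minpoly ℚ_p (ζ m) = Φ_{p^m}`** (`m ≥ 1`), `irreducible_cyclotomic`.
* §4 `layer p m = ℚ_p⟮ζ m⟯` (Kobayashi's `k_{m−1}`; `layer 0 = ⊥`): finite, monotone,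
  **`finrank_layer : [layer m : ℚ_p] = φ(p^m)`**, `mem_layer_of_pow_eq_one`, `exists_aeval_zeta_eq`
  (elements are `r(ζ m)`, `deg r < φ(p^m)`); Galois supply `exists_algEquiv_apply_zeta_eq_pow`
  (`σ ζ = ζ^a` for `p ∤ a`, conjugate roots of `Φ_{p^m}` — Mathlib `IsConjRoot.exists_algEquiv` for the
  normal extension `ℚ̄_p/ℚ_p`), `exists_apply_zeta_eq_pow`, `apply_eq_of_apply_zeta_eq`,
  `apply_eq_self_of_apply_zeta_eq`, `apply_mem_layer`, and the Galois correspondence on the layers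
  (`mem_layer_of_forall_apply_eq`, `mem_fixingSubgroup_layer_iff`: Mathlib
  `InfiniteGalois.fixedField_fixingSubgroup`).

References: [Kobayashi2003] §8.4; [SerreLocalFields1979] Ch. IV §4; [NeukirchANT1999] II (7.13);
[Tate1967] §3.1.
-/

noncomputable section

open scoped Classical IntermediateField
open Polynomial

namespace Summit.BirchSwinnertonDyer.Rank1Residual.Additive

namespace PadicCyclotomicTower

variable (p : ℕ) [hp : Fact p.Prime]

/-! ## §3 Orthogonality of the `π`-power basis and `minpoly ζ_{p^m} = Φ_{p^m}` -/

/-- The absolute values of the non-zero terms `c π^j` (`c ∈ ℚ_p`, `j < φ(p^m)`) are pairwise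
distinct (value group `p^ℤ` of `ℚ_p` versus `‖π‖^{φ(p^m)} = ‖p‖`). [cite: SerreLocalFields1979, Ch. IV §4] -/
theorem eq_of_norm_mul_norm_pow_eq {m : ℕ} (hm : 1 ≤ m) {c c' : ℚ_[p]} (hc : c ≠ 0)
    (hc' : c' ≠ 0) {j j' : ℕ} (hj : j < (p ^ m).totient) (hj' : j' < (p ^ m).totient)
    (h : ‖c‖ * ‖zeta p m - 1‖ ^ j = ‖c'‖ * ‖zeta p m - 1‖ ^ j') : j = j' := by
  set t : ℝ := ‖(p : PadicAlgCl p)‖ with ht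
  have ht0 : 0 < t := (Literature.NumberTheory.GaloisRepresentations.PadicAlgCl.norm_natCast_prime_pos_lt_one (p := p)).1
  have ht1 : t < 1 := (Literature.NumberTheory.GaloisRepresentations.PadicAlgCl.norm_natCast_prime_pos_lt_one (p := p)).2
  set φ : ℕ := (p ^ m).totient with hφ
  set π : PadicAlgCl p := zeta p m - 1 with hπdef
  have hπφ : ‖π‖ ^ φ = t := norm_zeta_sub_one_pow p hm
  -- `‖c‖ = t^v`, `‖c'‖ = t^{v'}` with `t = p⁻¹`
  have hnp : ‖(p : PadicAlgCl p)‖ = (p : ℝ)⁻¹ := by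
    rw [← map_natCast (algebraMap ℚ_[p] (PadicAlgCl p)) p]
    exact (PadicAlgCl.norm_extends (p := p) (p : ℚ_[p])).trans Padic.norm_p
  have hcv : ‖c‖ = t ^ c.valuation := by
    rw [Padic.norm_eq_zpow_neg_valuation hc, ht, hnp, inv_zpow', zpow_neg]
  have hcv' : ‖c'‖ = t ^ c'.valuation := by
    rw [Padic.norm_eq_zpow_neg_valuation hc', ht, hnp, inv_zpow', zpow_neg]
  set v : ℤ := c.valuation
  set v' : ℤ := c'.valuation
  have h2 := congrArg (fun x : ℝ => x ^ φ) h
  simp only [mul_pow] at h2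
  rw [← pow_mul, ← pow_mul, mul_comm j φ, mul_comm j' φ, pow_mul, pow_mul, hπφ, hcv, hcv',
    ← zpow_natCast (t ^ v) φ, ← zpow_natCast (t ^ v') φ, ← zpow_mul, ← zpow_mul,
    ← zpow_natCast t j, ← zpow_natCast t j', ← zpow_add₀ ht0.ne', ← zpow_add₀ ht0.ne'] at h2
  have hexp : v * (φ : ℤ) + (j : ℤ) = v' * (φ : ℤ) + (j' : ℤ) :=
    zpow_right_injective₀ ht0 ht1.ne h2
  have hdvd : (φ : ℤ) ∣ (j : ℤ) - j' := ⟨v' - v, by linear_combination hexp⟩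
  have habs : |(j : ℤ) - j'| < φ := by
    rw [abs_sub_lt_iff]; constructor <;> omega
  have := Int.eq_zero_of_abs_lt_dvd hdvd habs
  omega

/-- **Orthogonality of the `π`-power basis** (`π = ζ m − 1`): for `r ∈ ℚ_p[X]` of degree
`< φ(p^m)` every term is dominated by the sum, `‖r_j‖ ‖π‖^j ≤ ‖r(π)‖` (the non-zero terms have
pairwise distinct absolute values; Mathlib `IsUltrametricDist.norm_sum_eq_sup'_of_pairwise_ne`).
[cite: SerreLocalFields1979, Ch. IV §4] -/
theorem norm_coeff_mul_le_norm_aeval {m : ℕ} (hm : 1 ≤ m) (r : ℚ_[p][X])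
    (hr : r.natDegree < (p ^ m).totient) (j : ℕ) :
    ‖r.coeff j‖ * ‖zeta p m - 1‖ ^ j ≤ ‖aeval (zeta p m - 1) r‖ := by
  set π : PadicAlgCl p := zeta p m - 1 with hπdef
  by_cases hj0 : r.coeff j = 0
  · rw [hj0, norm_zero, zero_mul]; exact norm_nonneg _
  have hjdeg : j ≤ r.natDegree := le_natDegree_of_ne_zero hj0
  let f : ℕ → PadicAlgCl p := fun i => r.coeff i • π ^ i
  let S : Finset ℕ := (Finset.range (r.natDegree + 1)).filter fun i => r.coeff i ≠ 0
  have hsum : aeval π r = ∑ i ∈ S, f i := by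
    rw [aeval_eq_sum_range, Finset.sum_filter_of_ne]
    intro i _ hi h0
    apply hi
    change r.coeff i • π ^ i = 0
    rw [h0, zero_smul]
  have hjS : j ∈ S := by
    simp only [S, Finset.mem_filter, Finset.mem_range]
    exact ⟨Nat.lt_succ_of_le hjdeg, hj0⟩
  have hSne : S.Nonempty := ⟨j, hjS⟩
  have hnormf : ∀ i, ‖f i‖ = ‖r.coeff i‖ * ‖π‖ ^ i := fun i => by
    change ‖r.coeff i • π ^ i‖ = _
    rw [norm_smul, norm_pow]
  have hpair : Set.Pairwise (S : Set ℕ) fun i i' => ‖f i‖ ≠ ‖f i'‖ := by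
    intro i hi i' hi' hii' heq
    simp only [S, Finset.coe_filter, Finset.mem_range, Set.mem_setOf_eq] at hi hi'
    rw [hnormf, hnormf] at heq
    exact hii' (eq_of_norm_mul_norm_pow_eq p hm hi.2 hi'.2 (by omega) (by omega) heq)
  have key : ‖∑ i ∈ S, f i‖ = S.sup' hSne (fun i => ‖f i‖) :=
    IsUltrametricDist.norm_sum_eq_sup'_of_pairwise_ne hSne hpair
  rw [hsum, key, ← hnormf j]
  exact Finset.le_sup' (fun i => ‖f i‖) hjS

/-- `Φ_{p^m}(ζ m) = 0` over `ℚ_p`. [folklore] -/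
theorem aeval_zeta_cyclotomic (m : ℕ) : aeval (zeta p m) (cyclotomic (p ^ m) ℚ_[p]) = 0 := by
  rw [aeval_def, eval₂_eq_eval_map, map_cyclotomic, ← IsRoot.def, isRoot_cyclotomic_iff]
  exact isPrimitiveRoot_zeta p m

/-- **`minpoly_{ℚ_p} (ζ m) = Φ_{p^m}`** (`m ≥ 1`): `minpoly ∣ Φ_{p^m}` and its degree is at least
`φ(p^m)` by orthogonality (a monic relation of degree `d < φ(p^m)` in `ζ` is one of degree `d` in
`π = ζ − 1` with leading coefficient `1`). So `Φ_{p^m}` is irreducible over `ℚ_p`.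
[cite: SerreLocalFields1979, Ch. IV §4] [cite: NeukirchANT1999, Ch. II (7.13)] -/
theorem minpoly_zeta {m : ℕ} (hm : 1 ≤ m) : minpoly ℚ_[p] (zeta p m) = cyclotomic (p ^ m) ℚ_[p] := by
  have hint : IsIntegral ℚ_[p] (zeta p m) := Algebra.IsIntegral.isIntegral _
  set q : ℚ_[p][X] := minpoly ℚ_[p] (zeta p m) with hq
  have hqmonic : q.Monic := minpoly.monic hint
  have hΦmonic : (cyclotomic (p ^ m) ℚ_[p]).Monic := cyclotomic.monic _ _
  have hdvd : q ∣ cyclotomic (p ^ m) ℚ_[p] := minpoly.dvd ℚ_[p] _ (aeval_zeta_cyclotomic p m)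
  have hdeg : (p ^ m).totient ≤ q.natDegree := by
    by_contra hlt
    push Not at hlt
    set r : ℚ_[p][X] := q.comp (X + 1) with hr
    have hX1 : (X + 1 : ℚ_[p][X]).natDegree = 1 := by rw [← C_1, natDegree_X_add_C]
    have hrdeg : r.natDegree = q.natDegree := by rw [hr, natDegree_comp, hX1, mul_one]
    have hrlead : r.coeff q.natDegree = 1 := by
      have h1 : r.leadingCoeff = 1 := by
        rw [hr, leadingCoeff_comp (by rw [hX1]; exact one_ne_zero), hqmonic.leadingCoeff,
          show (X + 1 : ℚ_[p][X]) = X + C 1 by rw [C_1], leadingCoeff_X_add_C, one_pow, one_mul]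
      rwa [leadingCoeff, hrdeg] at h1
    have hraeval : aeval (zeta p m - 1) r = 0 := by
      rw [hr, aeval_comp, map_add, aeval_X, map_one, sub_add_cancel, hq, minpoly.aeval]
    have h := norm_coeff_mul_le_norm_aeval p hm r (by rw [hrdeg]; exact hlt) q.natDegree
    rw [hrlead, norm_one, one_mul, hraeval, norm_zero] at h
    exact absurd h (not_le.mpr (pow_pos (norm_zeta_sub_one_pos p hm) _))
  have hΦdeg : (cyclotomic (p ^ m) ℚ_[p]).natDegree ≤ q.natDegree := by
    rw [natDegree_cyclotomic]; exact hdeg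
  exact (Polynomial.eq_of_monic_of_dvd_of_natDegree_le hqmonic hΦmonic hdvd hΦdeg).symm

/-- **`Φ_{p^m}` is irreducible over `ℚ_p`.** [cite: SerreLocalFields1979, Ch. IV §4] -/
theorem irreducible_cyclotomic {m : ℕ} (hm : 1 ≤ m) : Irreducible (cyclotomic (p ^ m) ℚ_[p]) := by
  rw [← minpoly_zeta p hm]
  exact minpoly.irreducible (Algebra.IsIntegral.isIntegral _)

/-! ## §4 The layers `k m = ℚ_p(ζ_{p^m})` and the Galois supply -/

/-- **The `m`-th layer `ℚ_p(ζ_{p^m}) ⊆ ℚ̄_p`** (Kobayashi's `k_{m−1}`; `layer 0 = ℚ_p`).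
[cite: Kobayashi2003, §8.4] -/
def layer (m : ℕ) : IntermediateField ℚ_[p] (PadicAlgCl p) :=
  ℚ_[p]⟮zeta p m⟯

/-- Unfolding of `layer`. [folklore] -/
theorem layer_def (m : ℕ) : layer p m = ℚ_[p]⟮zeta p m⟯ := rfl

/-- `ζ m ∈ layer m`. [folklore] -/
theorem zeta_mem_layer (m : ℕ) : zeta p m ∈ layer p m :=
  IntermediateField.mem_adjoin_simple_self _ _

/-- `layer 0 = ⊥ = ℚ_p`. [folklore] -/
theorem layer_zero : layer p 0 = ⊥ := by
  rw [layer_def, zeta_zero, IntermediateField.adjoin_simple_eq_bot_iff]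
  exact one_mem _

/-- The layers are finite over `ℚ_p` (a theorem, to be introduced with `haveI`). [folklore] -/
theorem finiteDimensional_layer (m : ℕ) : FiniteDimensional ℚ_[p] (layer p m) :=
  IntermediateField.adjoin.finiteDimensional (Algebra.IsIntegral.isIntegral _)

/-- **`[ℚ_p(ζ_{p^m}) : ℚ_p] = φ(p^m)`** (`m ≥ 1`). [cite: SerreLocalFields1979, Ch. IV §4] -/
theorem finrank_layer {m : ℕ} (hm : 1 ≤ m) : Module.finrank ℚ_[p] (layer p m) = (p ^ m).totient := by
  rw [layer_def, IntermediateField.adjoin.finrank (Algebra.IsIntegral.isIntegral _), minpoly_zeta p hm,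
    natDegree_cyclotomic]

/-- `layer m` contains all `p^m`-th roots of unity. [folklore] -/
theorem mem_layer_of_pow_eq_one {m : ℕ} {x : PadicAlgCl p} (hx : x ^ p ^ m = 1) : x ∈ layer p m := by
  obtain ⟨i, -, rfl⟩ := (isPrimitiveRoot_zeta p m).eq_pow_of_pow_eq_one hx
  exact pow_mem (zeta_mem_layer p m) i

/-- The tower is increasing. [folklore] -/
theorem layer_mono : Monotone (layer p) := by
  intro m m' h
  obtain ⟨j, rfl⟩ := Nat.exists_eq_add_of_le h
  rw [layer_def, IntermediateField.adjoin_simple_le_iff, ← zeta_add_pow p m j]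
  exact pow_mem (zeta_mem_layer p (m + j)) _

/-- **Elements of `layer m` are polynomials in `ζ m` of degree `< φ(p^m)`** over `ℚ_p`.
[folklore] -/
theorem exists_aeval_zeta_eq {m : ℕ} {x : PadicAlgCl p} (hx : x ∈ layer p m) :
    ∃ r : ℚ_[p][X], r.natDegree < (p ^ m).totient ∧ aeval (zeta p m) r = x := by
  have halg : IsAlgebraic ℚ_[p] (zeta p m) := Algebra.IsAlgebraic.isAlgebraic _
  have hx' : x ∈ (layer p m).toSubalgebra := hx
  rw [layer_def, IntermediateField.adjoin_simple_toSubalgebra_of_isAlgebraic halg,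
    Algebra.adjoin_singleton_eq_range_aeval] at hx'
  obtain ⟨q, rfl⟩ := hx'
  have hΦmonic : (cyclotomic (p ^ m) ℚ_[p]).Monic := cyclotomic.monic _ _
  have hΦ1 : cyclotomic (p ^ m) ℚ_[p] ≠ 1 := by
    intro h
    have := congrArg natDegree h
    rw [natDegree_cyclotomic, natDegree_one] at this
    exact (Nat.totient_pos.mpr (pow_pos hp.out.pos m)).ne' this
  refine ⟨q %ₘ cyclotomic (p ^ m) ℚ_[p], ?_, ?_⟩
  · rw [← natDegree_cyclotomic (p ^ m) ℚ_[p]]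
    exact natDegree_modByMonic_lt q hΦmonic hΦ1
  · exact aeval_modByMonic_eq_self_of_root (aeval_zeta_cyclotomic p m)

/-- **Galois supply**: for `p ∤ a` there is `σ ∈ Aut(ℚ̄_p/ℚ_p)` with `σ (ζ m) = (ζ m)^a` (`ζ^a` is
a root of `Φ_{p^m} = minpoly ζ`; conjugates over `ℚ_p` are related by an automorphism of the normal
extension `ℚ̄_p/ℚ_p`, Mathlib `IsConjRoot.exists_algEquiv`). [cite: Tate1967, §3.1] -/
theorem exists_algEquiv_apply_zeta_eq_pow {m : ℕ} (hm : 1 ≤ m) {a : ℕ} (ha : a.Coprime p) :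
    ∃ σ : PadicAlgCl p ≃ₐ[ℚ_[p]] PadicAlgCl p, σ (zeta p m) = zeta p m ^ a := by
  have hprim : IsPrimitiveRoot (zeta p m ^ a) (p ^ m) :=
    (isPrimitiveRoot_zeta p m).pow_of_coprime a (ha.pow_right m)
  have hint : IsIntegral ℚ_[p] (zeta p m) := Algebra.IsIntegral.isIntegral _
  have hconj : IsConjRoot ℚ_[p] (zeta p m) (zeta p m ^ a) := by
    refine (isConjRoot_iff_mem_minpoly_aroots hint).mpr ?_
    rw [mem_aroots, minpoly_zeta p hm]
    refine ⟨(cyclotomic.monic _ _).ne_zero, ?_⟩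
    rw [aeval_def, eval₂_eq_eval_map, map_cyclotomic, ← IsRoot.def, isRoot_cyclotomic_iff]
    exact hprim
  obtain ⟨σ, hσ⟩ := hconj.exists_algEquiv
  exact ⟨σ.symm, σ.symm_apply_eq.mpr hσ.symm⟩

/-- Every automorphism maps `ζ m` to a power `(ζ m)^c`, `c < p^m`. [folklore] -/
theorem exists_apply_zeta_eq_pow (σ : PadicAlgCl p ≃ₐ[ℚ_[p]] PadicAlgCl p) (m : ℕ) :
    ∃ c < p ^ m, σ (zeta p m) = zeta p m ^ c := by
  have h1 : (σ (zeta p m)) ^ p ^ m = 1 := by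
    rw [← map_pow, (isPrimitiveRoot_zeta p m).pow_eq_one, map_one]
  obtain ⟨c, hc, h⟩ := (isPrimitiveRoot_zeta p m).eq_pow_of_pow_eq_one h1
  exact ⟨c, hc, h.symm⟩

/-- **Two automorphisms with the same action on `ζ m` agree on `layer m`.** [folklore] -/
theorem apply_eq_of_apply_zeta_eq {m : ℕ} {σ σ' : PadicAlgCl p ≃ₐ[ℚ_[p]] PadicAlgCl p}
    (h : σ (zeta p m) = σ' (zeta p m)) {x : PadicAlgCl p} (hx : x ∈ layer p m) : σ x = σ' x := by
  have halg : IsAlgebraic ℚ_[p] (zeta p m) := Algebra.IsAlgebraic.isAlgebraic _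
  have hx' : x ∈ (layer p m).toSubalgebra := hx
  rw [layer_def, IntermediateField.adjoin_simple_toSubalgebra_of_isAlgebraic halg] at hx'
  have hle : Algebra.adjoin ℚ_[p] {zeta p m} ≤
      AlgHom.equalizer (σ : PadicAlgCl p →ₐ[ℚ_[p]] PadicAlgCl p)
        (σ' : PadicAlgCl p →ₐ[ℚ_[p]] PadicAlgCl p) :=
    Algebra.adjoin_le (Set.singleton_subset_iff.mpr h)
  exact hle hx'

/-- An automorphism fixing `ζ m` fixes `layer m` pointwise. [folklore] -/
theorem apply_eq_self_of_apply_zeta_eq {m : ℕ} {σ : PadicAlgCl p ≃ₐ[ℚ_[p]] PadicAlgCl p}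
    (h : σ (zeta p m) = zeta p m) {x : PadicAlgCl p} (hx : x ∈ layer p m) : σ x = x := by
  have := apply_eq_of_apply_zeta_eq p (σ' := 1) (by rw [h]; rfl) hx
  rw [this]; rfl

/-- The layers are stable under every automorphism. [folklore] -/
theorem apply_mem_layer (σ : PadicAlgCl p ≃ₐ[ℚ_[p]] PadicAlgCl p) {m : ℕ} {x : PadicAlgCl p}
    (hx : x ∈ layer p m) : σ x ∈ layer p m := by
  have halg : IsAlgebraic ℚ_[p] (zeta p m) := Algebra.IsAlgebraic.isAlgebraic _
  have hx' : x ∈ (layer p m).toSubalgebra := hx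
  rw [layer_def, IntermediateField.adjoin_simple_toSubalgebra_of_isAlgebraic halg,
    Algebra.adjoin_singleton_eq_range_aeval] at hx'
  obtain ⟨q, rfl⟩ := hx'
  obtain ⟨c, -, hc⟩ := exists_apply_zeta_eq_pow p σ m
  change (σ : PadicAlgCl p →ₐ[ℚ_[p]] PadicAlgCl p) (aeval (zeta p m) q) ∈ layer p m
  have hy : zeta p m ^ c ∈ layer p m := pow_mem (zeta_mem_layer p m) c
  rw [← aeval_algHom_apply]
  change aeval (σ (zeta p m)) q ∈ layer p m
  rw [hc, show zeta p m ^ c = ((⟨_, hy⟩ : layer p m) : PadicAlgCl p) from rfl,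
    IntermediateField.aeval_coe]
  exact SetLike.coe_mem _

/-- **An element fixed by every automorphism fixing `ζ m` lies in `layer m`** (Galois
correspondence for `ℚ̄_p/ℚ_p`, Mathlib `InfiniteGalois.fixedField_fixingSubgroup`). [folklore] -/
theorem mem_layer_of_forall_apply_eq {m : ℕ} {x : PadicAlgCl p}
    (hx : ∀ σ : PadicAlgCl p ≃ₐ[ℚ_[p]] PadicAlgCl p, σ (zeta p m) = zeta p m → σ x = x) :
    x ∈ layer p m := by
  rw [← InfiniteGalois.fixedField_fixingSubgroup (layer p m)]
  intro σ
  have hσ : (σ : PadicAlgCl p ≃ₐ[ℚ_[p]] PadicAlgCl p) (zeta p m) = zeta p m := by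
    have := σ.2
    rw [IntermediateField.mem_fixingSubgroup_iff] at this
    exact this _ (zeta_mem_layer p m)
  exact hx σ hσ

/-- Membership in the fixing subgroup of `layer m` is fixing `ζ m`. [folklore] -/
theorem mem_fixingSubgroup_layer_iff {m : ℕ} (σ : PadicAlgCl p ≃ₐ[ℚ_[p]] PadicAlgCl p) :
    σ ∈ (layer p m).fixingSubgroup ↔ σ (zeta p m) = zeta p m := by
  rw [IntermediateField.mem_fixingSubgroup_iff]
  exact ⟨fun h => h _ (zeta_mem_layer p m), fun h x hx => apply_eq_self_of_apply_zeta_eq p h hx⟩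

end PadicCyclotomicTower

end Summit.BirchSwinnertonDyer.Rank1Residual.Additive

end
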